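import Literature.AnabelianGeometry.AbsoluteAnabelian.AbsTopIII.CurveModel
import Literature.AnabelianGeometry.AbsoluteAnabelian.AbsTopIThm26vHolds
import Literature.AnabelianGeometry.AbsoluteAnabelian.NFGaloisTFGNormalCorollaries
import Literature.AnabelianGeometry.AbsoluteAnabelian.SlimTransport
import HarnessLib

/-!
# [AbsTopIII] Rmk. 1.9.2 relative to a model: `Δ ⊆ Π` is group-theoretic — kernel proofs at the instance classes

Mochizuki, *Topics in Absolute Anabelian Geometry III*, §1, Rmk. 1.9.2, manuscript p. 38 (lit key
`paper:url-5493eb38cbb7`): "When `k` is an MLF or NF, the 'extension of profinite groups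
`1 → Δ_X → Π_X → G_k → 1`' [...] may be replaced by the single profinite group `Π_X` [cf. [AbsTopI]
Thm. 2.6 (v), (vi)]".  abc-iut-L4-t1 typed it as the NAMED FACT `CurveModel.Rmk_1_9_2 M` relative to
a model `M : CurveModel` (`CurveModel.lean`, FACT-LIST F-0236): every isomorphism of the profinite
groups `Π` between two curves of the model whose base fields are both MLF's or both NF's carries `Δ`
onto `Δ`.

`CurveModel` is an INTERFACE (no existence or coherence axiom; `CurveModel.lean` module text), so the
universal closure `∀ M, M.Rmk_1_9_2` ranges over junk models and is not a theorem (it is refuted in the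
sibling file `CurveModelSchemaRefutations.lean`).  This proof-only companion (no definitions, no new
named facts) PROVES `M.Rmk_1_9_2` on the instance classes at which print asserts it, by packaging the
tree's kernel theorems for abstract extensions `1 → Δ → Π → G → 1`:

* NF case — [AbsTopI] Thm. 2.6 (vi) "`Δ` is the maximal topologically finitely generated closed
  normal subgroup of `Π`": abc-iut-L4-t6's transport `geom_map_eq_of_geomIsMaxTFGNormalIn`
  (`AbsTopII/Remark332Proofs.lean`) over the DISCHARGED [AbsAnab] Thm. 1.1.2
  (`galoisNF_tfgNormalSubgroup_trivial_holds`, `geomIsMaxTFGNormalIn_of_nfBase`);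
* MLF case — [AbsTopI] Thm. 2.6 (v) "`Δ` is the intersection of the open `H ⊆ Π` with
  `ζ(H)/ζ(Π) = [Π : H]`": `preservesGeom_of_thm26v` over `thm26v_of_coinvariantRankConstant` /
  `thm26v_of_starCondition` (`AbsTopIThm26vProofs.lean`, via the PROVED [AbsAnab] Lemma 1.1.4 (ii)).

Results:

* `CurveModel.nonempty_nfBase` / `CurveModel.nonempty_mlfBase` — the model's `galIso : G ≅ Gal(k̄/k)`
  and `IsNF k` / `IsMLF k` inhabit abc-iut-L4-t4's base-field records `NFBase` / `MLFBase`;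
* `CurveModel.rmk_1_9_2_of_thm26v_of_geomIsMaxTFGNormalIn` — universe-polymorphic: `M.Rmk_1_9_2` for
  every model whose MLF-based curves satisfy the typed Thm. 2.6 (v) (`Thm26v`) and whose NF-based
  curves satisfy the maximality clause of Thm. 2.6 (vi) (`GeomIsMaxTFGNormalIn ⊤`);
* `CurveModel.rmk_1_9_2_of_geomTFG_of_coinvariantRankConstant` (universe `0`, where the tree's
  [AbsAnab] theorems live) — `M.Rmk_1_9_2` for every model in which `Δ_X` is topologically finitely
  generated for NF- and MLF-based `X` ([AbsTopI] Prop. 2.2) and `δ¹_l(Π′) − δ¹_l(G′)` is independent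
  of `l` for MLF-based `X` ([AbsTopI] Thm. 2.6 (ii) on open subgroups; `CoinvariantRankConstant`);
* `CurveModel.rmk_1_9_2_of_geomTFG_of_starCondition` — the same with the printed hypotheses of
  [AbsAnab] Lemma 1.1.4 (ii) (splitting over an open subgroup of `G`, `Δ` tfg, (∗)) in the MLF case.

HONEST FRAMING: refereed, undisputed statements ([AbsTopI], [AbsTopIII], [AbsAnab]); the regime
inputs (`Δ` tfg, `CoinvariantRankConstant` / (∗)) are what the geometry of a hyperbolic curve supplies
in print and stay hypotheses BY NAME on the model; nothing here bears on [IUTchIII] Cor. 3.12; typed ≠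
proved elsewhere.
-/

noncomputable section

open CategoryTheory

universe u

namespace Literature.AnabelianGeometry.AbsoluteAnabelian.AbsTopIII.CurveModel

open FundamentalExtension

variable (M : CurveModel.{u})

/-! ### Base-field records from the model's `galIso` -/

/-- For an NF-based curve `X` of a model, the identification `galIso : G ≅ Gal(k̄/k)` inhabits
abc-iut-L4-t4's record `NFBase` ("the base field is the number field `k`").
[cite: MochizukiAbsTopIII2015, Rmk 1.9.2 p.38] -/
theorem nonempty_nfBase (X : M.Curve) (hX : IsNF (M.base X)) : Nonempty (M.ext X).NFBase := by
  haveI : NumberField (M.base X) := hX.numberField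
  obtain ⟨e⟩ := nonempty_continuousMulEquiv_of_iso (M.galIso X)
  exact ⟨{ F := M.base X, galIso := e }⟩

/-- For an MLF-based curve `X` of a model, the identification `galIso : G ≅ Gal(k̄/k)` inhabits
abc-iut-L4-t4's record `MLFBase` ("the base field is the MLF `k`", with some `ℚ_p`-algebra structure of
finite degree on `k`). [cite: MochizukiAbsTopIII2015, Rmk 1.9.2 p.38] -/
theorem nonempty_mlfBase (X : M.Curve) (hX : IsMLF (M.base X)) : Nonempty (M.ext X).MLFBase := by
  obtain ⟨p, hp, f, hf⟩ := hX.exists_padic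
  letI : Algebra ℚ_[p] (M.base X) := f.toAlgebra
  haveI : FiniteDimensional ℚ_[p] (M.base X) := hf
  obtain ⟨e⟩ := nonempty_continuousMulEquiv_of_iso (M.galIso X)
  exact ⟨{ p := p, K := M.base X, galIso := e }⟩

/-! ### Rmk. 1.9.2 from the typed characterizations of [AbsTopI] Thm. 2.6 (v), (vi) -/

/-- **Rmk. 1.9.2 relative to `M`, from the typed [AbsTopI] Thm. 2.6 (v)/(vi)** (universe-polymorphic):
if every MLF-based curve of the model satisfies `Thm26v` for some MLF base datum ("`Δ` is the
intersection of the open subgroups `H ⊆ Π` such that `ζ̃(H)/ζ̃(Π) = [Π : H]`") and every NF-based curve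
satisfies the maximality clause of Thm. 2.6 (vi) ("`Δ` is the maximal topologically finitely generated
closed normal subgroup of `Π`"), then every isomorphism `Π_X ⥲ Π_Y` between two MLF-based or two
NF-based curves carries `Δ_X` onto `Δ_Y` — "the extension [...] may be replaced by the single profinite
group `Π_X`". [cite: MochizukiAbsTopIII2015, Rmk 1.9.2 p.38] -/
theorem rmk_1_9_2_of_thm26v_of_geomIsMaxTFGNormalIn
    (hv : ∀ X : M.Curve, IsMLF (M.base X) → ∃ B : (M.ext X).MLFBase, (M.ext X).Thm26v B)
    (hvi : ∀ X : M.Curve, IsNF (M.base X) → (M.ext X).GeomIsMaxTFGNormalIn ⊤) :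
    M.Rmk_1_9_2 := by
  intro X Y hXY e
  rcases hXY with ⟨hX, hY⟩ | ⟨hX, hY⟩
  · obtain ⟨BX, hBX⟩ := hv X hX
    obtain ⟨BY, hBY⟩ := hv Y hY
    exact preservesGeom_of_thm26v hBX hBY e
  · exact geom_map_eq_of_geomIsMaxTFGNormalIn (hvi X hX) (hvi Y hY) e

/-! ### Rmk. 1.9.2 from the regime hypotheses of the printed proofs (universe `0`) -/

/-- **Rmk. 1.9.2 relative to `M : CurveModel.{0}`, regime form** — the Thm. 2.6 (v)/(vi)
characterizations DISCHARGED by the tree: if `Δ_X` is topologically finitely generated for every NF- or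
MLF-based curve `X` of the model ([AbsTopI] Prop. 2.2) and, for MLF-based `X`,
`δ¹_l(Π′) − δ¹_l(G′)` is independent of the prime `l` for every open `Π′ ⊆ Π_X`
(`CoinvariantRankConstant`, [AbsTopI] Thm. 2.6 (ii) applied to open subgroups), then `M.Rmk_1_9_2`:
NF case by [AbsAnab] Thm. 1.1.2 (`galoisNF_tfgNormalSubgroup_trivial_holds`) ⟹ Lemma 1.1.4 (i) ⟹
Thm. 2.6 (vi) (`geomIsMaxTFGNormalIn_of_nfBase`); MLF case by [AbsAnab] Lemma 1.1.4 (ii) ⟹ Thm. 2.6 (v)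
(`thm26v_of_coinvariantRankConstant`). [cite: MochizukiAbsTopIII2015, Rmk 1.9.2 p.38] -/
theorem rmk_1_9_2_of_geomTFG_of_coinvariantRankConstant (M : CurveModel.{0})
    (hNF : ∀ X : M.Curve, IsNF (M.base X) → (M.ext X).GeomTFG)
    (hMLF : ∀ X : M.Curve, IsMLF (M.base X) →
      (M.ext X).GeomTFG ∧ (M.ext X).CoinvariantRankConstant) :
    M.Rmk_1_9_2 := by
  refine M.rmk_1_9_2_of_thm26v_of_geomIsMaxTFGNormalIn (fun X hX => ?_) (fun X hX => ?_)
  · obtain ⟨B⟩ := M.nonempty_mlfBase X hX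
    exact ⟨B, (M.ext X).thm26v_of_coinvariantRankConstant B (hMLF X hX).1 (hMLF X hX).2⟩
  · obtain ⟨B⟩ := M.nonempty_nfBase X hX
    refine geomIsMaxTFGNormalIn_of_nfBase (M.ext X) B (hNF X hX) ⊤ ?_
    rw [Subgroup.coe_top]
    exact isOpen_univ

/-- **Rmk. 1.9.2 relative to `M : CurveModel.{0}`, with the printed hypotheses of [AbsAnab] Lemma
1.1.4 (ii) in the MLF case** (the extension splits over an open subgroup of `G`, `Δ` topologically
finitely generated, condition (∗) `StarCondition`) and `Δ` topologically finitely generated in the NF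
case: then `M.Rmk_1_9_2` (MLF case through `thm26v_of_starCondition` over the PROVED `lemma114_ii_holds`).
[cite: MochizukiAbsTopIII2015, Rmk 1.9.2 p.38] -/
theorem rmk_1_9_2_of_geomTFG_of_starCondition (M : CurveModel.{0})
    (hNF : ∀ X : M.Curve, IsNF (M.base X) → (M.ext X).GeomTFG)
    (hMLF : ∀ X : M.Curve, IsMLF (M.base X) →
      (M.ext X).SplitsOverOpenSubgroup ∧ (M.ext X).GeomTFG ∧ (M.ext X).StarCondition) :
    M.Rmk_1_9_2 := by
  refine M.rmk_1_9_2_of_thm26v_of_geomIsMaxTFGNormalIn (fun X hX => ?_) (fun X hX => ?_)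
  · obtain ⟨B⟩ := M.nonempty_mlfBase X hX
    obtain ⟨hs, hΔ, hstar⟩ := hMLF X hX
    exact ⟨B, (M.ext X).thm26v_of_starCondition B hs hΔ hstar⟩
  · obtain ⟨B⟩ := M.nonempty_nfBase X hX
    refine geomIsMaxTFGNormalIn_of_nfBase (M.ext X) B (hNF X hX) ⊤ ?_
    rw [Subgroup.coe_top]
    exact isOpen_univ

end Literature.AnabelianGeometry.AbsoluteAnabelian.AbsTopIII.CurveModel
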